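import Summits.NavierStokesRegularity.NavierStokesRegularity.Theorems.SymmetricLiouville.Negative.LoadBearing
import Literature.Analysis.FluidPDE.TypeIAncientMild
import Literature.Analysis.FluidPDE.SwirlTransportProofs

/-!
# Crux `SymmetricLiouville` (stmt-NavierStokesRegularity-4053), negative side, cycle 2:
the screw clause integrates (periodicity along the axis; `IsAxisymmetric` from the clause)

Negative-side (cdisprove, D-0016) support lemmas extracted from
`Cruxes/SymmetricLiouville/Disproof.lean` (v7, gen-2 seat, §(f)) of route `SymmetryModuliCount`.
The crux states its symmetry infinitesimally (`L_ξ u = 0`, clause `HasSymmetry` of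
`LoadBearing.lean`); the lines attacking its screw/rotation leaves use the finite forms
(`IsAxisymmetric`, `2πh`-periodicity along the axis). The bridge is an ODE fact with no
Navier–Stokes content, recorded here kernel-checked (stub-audit item: the sketches'
`HelicalIsPeriodic` / `periodic_of_screw` are TRUE, and the `IsAxisymmetric` hypotheses of the axis
stubs are faithful to the crux):

* `screw_equivariant` — `Du(y)[h e_z + J y] = J u(y)` for all `y` (the clause for `ξ = (h e_z, 0, J)`)
  implies `u(R_θ x + θh e_z) = R_θ u(x)`; proof: `w = u∘γ − R_θ u(x)` solves `w' = Jw`, `w(0) = 0`,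
  and `J` is skew (`inner_rotGen_self`), so `‖w‖²` is constant;
* `periodic_of_screw_clause` (`u(x + 2πh e_z) = u(x)`), `isAxisymmetric_of_clause` (`h = 0`);
* on the class: `InClass.periodic_of_hasSymmetry_screw`, `InClass.isAxisymmetric_of_hasSymmetry_rot`,
  and `isSkew_rotGenL` (the generator `J = rotGenL` satisfies the crux's `IsSkew`).

No route statement is changed (`--supports`).
-/

noncomputable section

namespace Summit.NavierStokesRegularity.NavierStokesRegularity.Theorems.SymmetricLiouville.Negative

open Literature.Analysis.FluidPDE MeasureTheory Set Function
open scoped RealInnerProductSpace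

local notation "E3" => EuclideanSpace ℝ (Fin 3)

/-- `J e_z = 0`. -/
theorem rotGen_ez : rotGen ez = 0 := rotGen_single_two

/-- `⟪J v, v⟫ = 0`: the rotation generator is skew (so `rotGenL` satisfies `IsSkew`). -/
theorem inner_rotGen_self (v : E3) : ⟪rotGen v, v⟫ = 0 := by
  rw [inner_rotGen_left]; ring

/-- `rotGenL` satisfies the crux's `IsSkew`. -/
theorem isSkew_rotGenL : IsSkew rotGenL := fun v => by
  rw [rotGenL_apply]; exact inner_rotGen_self v

/-- The velocity of `θ ↦ R_θ x` is `J (R_θ x)` (the tree's `hasDerivAt_rotZ`, rewritten). -/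
theorem hasDerivAt_rotZ_rotGen (x : E3) (θ : ℝ) :
    HasDerivAt (fun φ => rotZ φ x) (rotGen (rotZ θ x)) θ := by
  have h := hasDerivAt_rotZ x θ
  have e : -Real.sin θ • (WithLp.toLp 2 ![x 0, x 1, 0] : E3) + Real.cos θ • rotGen x =
      rotGen (rotZ θ x) := by
    ext i
    fin_cases i <;> simp [rotGen] <;> ring
  rwa [e] at h

/-- **Integrating the screw clause.** If a differentiable field satisfies
`Du(y)[h e_z + J y] = J u(y)` for all `y` — the crux's clause for `ξ = (h e_z, 0, J)`, a screw motion
of pitch `h` about the `z`-axis (`h = 0`: a rotation) — then `u(R_θ x + θh e_z) = R_θ u(x)` for every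
`θ` and `x`. -/
theorem screw_equivariant {u : E3 → E3} (hu : Differentiable ℝ u) (h : ℝ)
    (hcl : ∀ y, fderiv ℝ u y (h • ez + rotGen y) = rotGen (u y)) (θ : ℝ) (x : E3) :
    u (rotZ θ x + (θ * h) • ez) = rotZ θ (u x) := by
  -- the orbit and its velocity
  set γ : ℝ → E3 := fun φ => rotZ φ x + (φ * h) • ez with hγ
  have hγd : ∀ φ, HasDerivAt γ (rotGen (rotZ φ x) + h • ez) φ := by
    intro φ
    have h1 := hasDerivAt_rotZ_rotGen x φ
    have h2 : HasDerivAt (fun ψ : ℝ => (ψ * h) • ez) ((1 * h) • ez) φ :=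
      ((hasDerivAt_id φ).mul_const h).smul_const ez
    rw [one_mul] at h2
    exact h1.add h2
  -- `w = u ∘ γ − R_θ u(x)` solves `w' = J w`
  set w : ℝ → E3 := fun φ => u (γ φ) - rotZ φ (u x) with hw
  have hwd : ∀ φ, HasDerivAt w (rotGen (w φ)) φ := by
    intro φ
    have hu1 : HasDerivAt (fun ψ => u (γ ψ)) (fderiv ℝ u (γ φ) (rotGen (rotZ φ x) + h • ez)) φ :=
      (hu (γ φ)).hasFDerivAt.comp_hasDerivAt φ (hγd φ)
    have hJγ : rotGen (rotZ φ x) + h • ez = h • ez + rotGen (γ φ) := by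
      rw [hγ]
      simp only [rotGen_add, rotGen_smul, rotGen_ez, smul_zero, add_zero]
      rw [add_comm]
    rw [hJγ, hcl (γ φ)] at hu1
    have hu2 := hasDerivAt_rotZ_rotGen (u x) φ
    have h3 := hu1.sub hu2
    have e : rotGen (u (γ φ)) - rotGen (rotZ φ (u x)) = rotGen (w φ) := by
      rw [hw]
      simp only [← rotGenL_apply, map_sub]
    rw [e] at h3
    exact h3
  -- `‖w‖²` is constant (J is skew), and `w 0 = 0`
  have hn : ∀ φ, HasDerivAt (fun ψ => ⟪w ψ, w ψ⟫) 0 φ := by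
    intro φ
    have h1 := (hwd φ).inner ℝ (hwd φ)
    have e : ⟪w φ, rotGen (w φ)⟫ + ⟪rotGen (w φ), w φ⟫ = 0 := by
      rw [real_inner_comm, inner_rotGen_self, add_zero]
    rwa [e] at h1
  have hconst : ∀ φ, ⟪w φ, w φ⟫ = ⟪w 0, w 0⟫ := fun φ =>
    is_const_of_deriv_eq_zero (fun ψ => (hn ψ).differentiableAt) (fun ψ => (hn ψ).deriv) φ 0
  have hw0 : w 0 = 0 := by simp [hw, hγ]
  have hwθ : w θ = 0 := by
    have h1 := hconst θ
    rw [hw0, inner_zero_left, real_inner_self_eq_norm_sq] at h1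
    have : ‖w θ‖ = 0 := by nlinarith [norm_nonneg (w θ)]
    exact norm_eq_zero.1 this
  have : u (γ θ) - rotZ θ (u x) = 0 := hwθ
  rw [hγ] at this
  exact sub_eq_zero.1 this

/-- `R_{2π} = id`. -/
theorem rotZ_two_pi (x : E3) : rotZ (2 * Real.pi) x = x := by
  ext i
  fin_cases i <;> simp

/-- **Screw-invariant fields are periodic along the axis** (the stub `HelicalIsPeriodic` /
`periodic_of_screw` in normal form): with the clause for `ξ = (h e_z, 0, J)`,
`u(x + 2πh e_z) = u(x)` — for EVERY `h` (also `h = 0`, trivially). -/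
theorem periodic_of_screw_clause {u : E3 → E3} (hu : Differentiable ℝ u) (h : ℝ)
    (hcl : ∀ y, fderiv ℝ u y (h • ez + rotGen y) = rotGen (u y)) (x : E3) :
    u (x + (2 * Real.pi * h) • ez) = u x := by
  have key := screw_equivariant hu h hcl (2 * Real.pi) x
  rwa [rotZ_two_pi, rotZ_two_pi] at key

/-- **Rotation-invariant fields are axisymmetric** (`h = 0`): the crux's infinitesimal clause
`Du(y)[J y] = J u(y)` is the tree's `IsAxisymmetric` (finite equivariance under all `R_θ`) for
differentiable fields; the converse is the tree's `IsAxisymmetric.fderiv_rotGen`. -/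
theorem isAxisymmetric_of_clause {u : E3 → E3} (hu : Differentiable ℝ u)
    (hcl : ∀ y, fderiv ℝ u y (rotGen y) = rotGen (u y)) : IsAxisymmetric u := by
  intro θ x
  have key := screw_equivariant hu 0 (fun y => by rw [zero_smul, zero_add]; exact hcl y) θ x
  rwa [mul_zero, zero_smul, add_zero] at key

/-- The crux's clause `HasSymmetry u (h • e_z) 0 rotGenL` IS the screw clause slice by slice, so an
element of `𝒜_C` annihilated by `ξ = (h e_z, 0, J)` is `2πh`-periodic along the axis on every slice
and, for `h = 0`, axisymmetric on every slice. -/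
theorem InClass.periodic_of_hasSymmetry_screw {C : ℝ} {u : ℝ → E3 → E3} (hu : InClass C u)
    (h : ℝ) (hsym : HasSymmetry u (h • ez) 0 rotGenL) {t : ℝ} (ht : t < 0) (x : E3) :
    u t (x + (2 * Real.pi * h) • ez) = u t x := by
  have hcl : IsTypeIAncientMild C u := by rw [isTypeIAncientMild_iff]; exact hu
  have hdiff : Differentiable ℝ (u t) := (hcl.contDiff_slice ht).differentiable (by simp)
  refine periodic_of_screw_clause hdiff h (fun y => ?_) x
  have e := hsym t ht y
  simp only [zero_smul, add_zero, rotGenL_apply, mul_zero, zero_mul, sub_eq_zero] at e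
  exact e

/-- The rotation case of the previous lemma: `HasSymmetry u 0 0 rotGenL` gives `IsAxisymmetric (u t)`
for every `t < 0`. -/
theorem InClass.isAxisymmetric_of_hasSymmetry_rot {C : ℝ} {u : ℝ → E3 → E3} (hu : InClass C u)
    (hsym : HasSymmetry u 0 0 rotGenL) {t : ℝ} (ht : t < 0) : IsAxisymmetric (u t) := by
  have hcl : IsTypeIAncientMild C u := by rw [isTypeIAncientMild_iff]; exact hu
  have hdiff : Differentiable ℝ (u t) := (hcl.contDiff_slice ht).differentiable (by simp)
  refine isAxisymmetric_of_clause hdiff fun y => ?_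
  have e := hsym t ht y
  simp only [zero_smul, add_zero, zero_add, rotGenL_apply, mul_zero, zero_mul, sub_eq_zero] at e
  exact e


end Summit.NavierStokesRegularity.NavierStokesRegularity.Theorems.SymmetricLiouville.Negative

end
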